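import Literature.InformationTheory.Entropy.VonNeumannEntropy
import Literature.LinearAlgebra.Matrix.HermitianCfcDiagonalForm
import Mathlib.Analysis.Convex.Jensen
import Mathlib.Analysis.Convex.SpecificFunctions.Basic
import HarnessLib

/-!
# The Rényi-2 (purity) lower bound on the von Neumann entropy: `S(ρ) ≥ −log tr(ρ²)`

Topic `InformationTheory/Entropy`, namespace `Literature.InformationTheory.Entropy`.

For a density matrix `ρ` (positive semidefinite, unit trace) the von Neumann entropy dominates the collision
(Rényi-2) entropy: `S(ρ) = −Σ_i λ_i log λ_i ≥ −log Σ_i λ_i² = −log tr(ρ²)` — Jensen's inequality for the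
concave `log` with weights `λ_i` (monotonicity of the Rényi entropies in the order,
[cite: NielsenChuang2010, §11.3 Exercise 11.12]; [cite: CoverThomas2006, Theorem 2.7.3] for Jensen).

* `neg_log_sum_sq_le_sum_negMulLog` — the scalar inequality for a probability vector;
* `re_trace_mul_self_eq_sum_eigenvalues_sq` — `tr(ρ²) = Σ_i λ_i²`;
* `neg_log_trace_sq_le_vonNeumannEntropy` — `−log Re tr(ρ·ρ) ≤ S(ρ)`;
* `neg_log_le_vonNeumannEntropy_of_trace_sq_le` — the CERTIFICATE form: a certified purity ceiling
  `Re tr(ρ·ρ) ≤ P` gives the certified entropy floor `−log P ≤ S(ρ)` (e.g. `tr ρ²` of a matrix-product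
  density operator is an exact rational contraction), which feeds the Gibbs variational principle
  `S(ρ) − β tr(ρH) ≤ log Z_β` as a trial free energy WITH entropy.

Everything is PROVED; no definition, no named fact.
-/

noncomputable section

namespace Literature.InformationTheory.Entropy

open Matrix Finset Literature.LinearAlgebra.Matrix
open scoped ComplexOrder BigOperators

/-! ### The scalar inequality -/

/-- **Collision entropy ≤ Shannon entropy**: for weights `w_i ≥ 0` with `Σ_i w_i = 1`,
`−log (Σ_i w_i²) ≤ Σ_i η(w_i)`, `η(t) = −t log t` (Jensen for the concave `log` with weights `w` at the
points `w`). [cite: CoverThomas2006, Theorem 2.7.3] -/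
theorem neg_log_sum_sq_le_sum_negMulLog {ι : Type*} (s : Finset ι) (w : ι → ℝ) (hw0 : ∀ i ∈ s, 0 ≤ w i)
    (hw1 : ∑ i ∈ s, w i = 1) :
    -Real.log (∑ i ∈ s, w i ^ 2) ≤ ∑ i ∈ s, Real.negMulLog (w i) := by
  classical
  -- restrict to the support of `w`
  set t := s.filter (fun i => 0 < w i) with ht
  have hts : t ⊆ s := Finset.filter_subset _ _
  have hzero : ∀ i ∈ s, i ∉ t → w i = 0 := by
    intro i hi hit
    have h1 := hw0 i hi
    have h2 : ¬ 0 < w i := by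
      intro h
      exact hit (Finset.mem_filter.2 ⟨hi, h⟩)
    linarith [not_lt.1 h2]
  have hsum_t : ∑ i ∈ t, w i = 1 := by
    rw [← hw1]
    exact Finset.sum_subset hts fun i hi hit => hzero i hi hit
  have hsq_t : ∑ i ∈ t, w i ^ 2 = ∑ i ∈ s, w i ^ 2 :=
    Finset.sum_subset hts fun i hi hit => by rw [hzero i hi hit]; ring
  have hneg_t : ∑ i ∈ t, Real.negMulLog (w i) = ∑ i ∈ s, Real.negMulLog (w i) :=
    Finset.sum_subset hts fun i hi hit => by rw [hzero i hi hit, Real.negMulLog_zero]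
  -- Jensen on the support
  have hJ := (strictConcaveOn_log_Ioi.concaveOn).le_map_sum (t := t) (w := w) (p := w)
    (fun i hi => (Finset.mem_filter.1 hi).2.le) hsum_t (fun i hi => Set.mem_Ioi.2 (Finset.mem_filter.1 hi).2)
  simp only [smul_eq_mul] at hJ
  -- `Σ_t w log w ≤ log (Σ_t w·w)`
  have hsq' : ∑ i ∈ t, w i * w i = ∑ i ∈ s, w i ^ 2 := by
    rw [← hsq_t]
    exact Finset.sum_congr rfl fun i _ => by ring
  rw [hsq'] at hJ
  rw [← hneg_t]
  have hneg : ∑ i ∈ t, Real.negMulLog (w i) = -∑ i ∈ t, w i * Real.log (w i) := by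
    rw [← Finset.sum_neg_distrib]
    exact Finset.sum_congr rfl fun i _ => by rw [Real.negMulLog]; ring
  rw [hneg]
  linarith

/-! ### The matrix inequality -/

variable {n : Type*} [Fintype n] [DecidableEq n]

/-- `Re tr(ρ·ρ) = Σ_i λ_i²` for a Hermitian `ρ`. [cite: NielsenChuang2010, §2.1.9] -/
theorem re_trace_mul_self_eq_sum_eigenvalues_sq {ρ : Matrix n n ℂ} (hρ : ρ.IsHermitian) :
    (ρ * ρ).trace.re = ∑ i, hρ.eigenvalues i ^ 2 := by
  have h := trace_cfc_eq_sum_eigenvalues hρ (fun x : ℝ => x ^ 2)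
  rw [cfc_pow_id ρ 2 hρ.isSelfAdjoint, pow_two] at h
  rw [h]
  exact Complex.ofReal_re _

/-- **The Rényi-2 lower bound on the von Neumann entropy**: for a density matrix `ρ`,
`−log Re tr(ρ·ρ) ≤ S(ρ)`. [cite: NielsenChuang2010, §11.3 Exercise 11.12] -/
theorem neg_log_trace_sq_le_vonNeumannEntropy {ρ : Matrix n n ℂ} (hρ : ρ.PosSemidef) (htr : ρ.trace = 1) :
    -Real.log ((ρ * ρ).trace.re) ≤ vonNeumannEntropy ρ := by
  rw [vonNeumannEntropy_eq hρ.1, re_trace_mul_self_eq_sum_eigenvalues_sq hρ.1]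
  exact neg_log_sum_sq_le_sum_negMulLog Finset.univ _ (fun i _ => hρ.eigenvalues_nonneg i)
    (sum_eigenvalues_eq_one hρ.1 htr)

/-- The purity of a density matrix is positive: `0 < Re tr(ρ·ρ)`. [cite: NielsenChuang2010, §2.4.1] -/
theorem re_trace_mul_self_pos {ρ : Matrix n n ℂ} (hρ : ρ.PosSemidef) (htr : ρ.trace = 1) :
    0 < (ρ * ρ).trace.re := by
  rw [re_trace_mul_self_eq_sum_eigenvalues_sq hρ.1]
  -- some eigenvalue is positive since they sum to `1`
  have hsum := sum_eigenvalues_eq_one hρ.1 htr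
  by_contra h
  have hle : ∑ i, hρ.1.eigenvalues i ^ 2 ≤ 0 := not_lt.1 h
  have hall : ∀ i, hρ.1.eigenvalues i = 0 := by
    intro i
    have h0 : hρ.1.eigenvalues i ^ 2 ≤ 0 := by
      have := Finset.single_le_sum (fun j _ => sq_nonneg (hρ.1.eigenvalues j)) (Finset.mem_univ i)
      linarith
    nlinarith [sq_nonneg (hρ.1.eigenvalues i)]
  rw [Finset.sum_congr rfl fun i _ => hall i, Finset.sum_const_zero] at hsum
  exact zero_ne_one hsum

/-- **Certificate form**: a certified purity ceiling `Re tr(ρ·ρ) ≤ P` yields the certified entropy floor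
`−log P ≤ S(ρ)` (e.g. from an exactly contracted `tr ρ²` of a matrix-product density operator), to be fed
into the Gibbs variational principle as a trial free energy with entropy. [cite: NielsenChuang2010, §11.3 Exercise 11.12] -/
theorem neg_log_le_vonNeumannEntropy_of_trace_sq_le {ρ : Matrix n n ℂ} (hρ : ρ.PosSemidef) (htr : ρ.trace = 1)
    {P : ℝ} (hP : (ρ * ρ).trace.re ≤ P) : -Real.log P ≤ vonNeumannEntropy ρ := by
  refine le_trans ?_ (neg_log_trace_sq_le_vonNeumannEntropy hρ htr)
  exact neg_le_neg (Real.log_le_log (re_trace_mul_self_pos hρ htr) hP)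

end Literature.InformationTheory.Entropy

end
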